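import Mathlib
import Literature.Analysis.OperatorTheory.ContractiveDetComplexity
import Literature.Computability.AlgebraicComplexity.DeterminantalComplexity
import Literature.LinearAlgebra.Matrix.MvPolynomialDetDegree
import HarnessLib

/-!
# Crux `PriceOfContractivity` (stmt-ValiantsHypothesis-10583), line `birth` — stub
# `stub_priceOfContractivity_twoVar`: the TWO-VARIABLE case of the crux

Route `ValiantsHypothesis/ContractivityPrice`, crux K1
(`Summit.ValiantsHypothesis.ValiantsHypothesis.Theses.ContractivityPrice.PriceOfContractivity`):
a polynomial `p` over `ℂ` in `≤ N` variables with an affine determinantal representation of size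
`m` and no zero on the closed polydisc of radius `2` has a contractive Sylvester realization
`p = p(0) · det (1 + diag (X ∘ κ) · K)`, `‖K‖_op ≤ 1`, of size `R ≤ 2 ^ ((log₂ (m + N) + d) ^ d)`.
This file proves the registered partial case `stub_priceOfContractivity_twoVar`: the restriction
to `N ≤ 2` with `d = 2`, CONDITIONALLY on the published two-variable theorem of
Grinshpan–Kaliuzhnyi-Verbovetskyi–Vinnikov–Woerdeman [GrinshpanEtAl2014, Thm. 2.1], whose
statement (in the route's inline Sylvester vocabulary) is the explicit first hypothesis of the
theorem: every non-constant bivariate `p` with `p(0) = 1` and no zero in the open polydisc `r𝔻²`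
is `det (1 + diag (X ∘ κ) · K)` of size `deg₀ p + deg₁ p` with `#κ⁻¹(j) = deg_j p` and
`‖K‖_op ≤ r⁻¹`.

## Proof

Zero-freeness at `z = 0` gives `p(0) ≠ 0`; the normalised polynomial `q = p / p(0)` has
`q(0) = 1`, the same zeros, and total degree `≤ m` (an `m × m` determinant of affine entries has
total degree `≤ m`, `Literature.LinearAlgebra.Matrix.totalDegree_det_le`). Since `#σ ≤ N ≤ 2`
there is an injection `f : σ ↪ Fin 2`; the renamed polynomial `q̂ = rename f q` is bivariate with
`q̂(0) = 1`, no zero on the closed (a fortiori the open) bidisc of radius `2`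
(`MvPolynomial.eval_rename`), and total degree `≤ m`. If `q̂` is constant then `q̂ = 1`, so
`q = 1` (`rename f` is injective) and `p = C (p 0)` is realized by the empty matrix (`R = 0`).
Otherwise `σ` is nonempty, `f` has a left inverse `g`, and the hypothesis at `r = 2` realizes
`q̂ = det (1 + diag (X ∘ κ̂) · K)` with `‖K‖_op ≤ 1/2 ≤ 1` at size
`R = deg₀ q̂ + deg₁ q̂ ≤ 2m ≤ 2 ^ (log₂ m + 2) ≤ 2 ^ ((log₂ (m + N) + 2) ^ 2)`; renaming back along
`g` (`rename g ∘ rename f = id`, and renaming a pencil determinant renames its colouring) gives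
`q = det (1 + diag (X ∘ (g ∘ κ̂)) · K)`, i.e. `p = C (p 0) · det (1 + diag (X ∘ (g ∘ κ̂)) · K)`.

## References

* [GrinshpanEtAl2014] A. Grinshpan, D. S. Kaliuzhnyi-Verbovetskyi, V. Vinnikov, H. J. Woerdeman,
  Stable and real-zero polynomials in two variables, Multidimens. Syst. Signal Process. 27 (2016)
  1–26 = arXiv:1306.6655, Theorem 2.1 (p. 4) — used only as the explicit hypothesis.
-/

noncomputable section

-- `Summit.<Summit>.<Problem>` repeats `ValiantsHypothesis` by the tree's layout convention (D-0017).
set_option linter.dupNamespace false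

namespace Summit.ValiantsHypothesis.ValiantsHypothesis.Theorems.PriceOfContractivity.TwoVar

open Matrix MvPolynomial
open Literature.Analysis.OperatorTheory (eval_det_one_add_diagonal_mul_map_C)
open Literature.Computability.AlgebraicComplexity (HasDetRepr)

/-! ### Bookkeeping lemmas -/

/-- Renaming the variables of a Sylvester pencil determinant renames its colouring:
`rename g (det (1 + diag (X ∘ κ) · K)) = det (1 + diag (X ∘ g ∘ κ) · K)` (`rename g` is a ring
homomorphism fixing the constants, so it commutes with `det` entrywise). [folklore] -/
theorem rename_pencil_det {τ σ : Type} {n : Type} [Fintype n] [DecidableEq n]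
    (g : τ → σ) (K : Matrix n n ℂ) (κ : n → τ) :
    MvPolynomial.rename g
        (1 + Matrix.diagonal (fun i => MvPolynomial.X (κ i)) *
          K.map (fun a : ℂ => (MvPolynomial.C a : MvPolynomial τ ℂ))).det =
      (1 + Matrix.diagonal (fun i => MvPolynomial.X (g (κ i))) *
          K.map (fun a : ℂ => (MvPolynomial.C a : MvPolynomial σ ℂ))).det := by
  rw [AlgHom.map_det, map_add, map_one, map_mul, AlgHom.mapMatrix_apply, AlgHom.mapMatrix_apply,
    diagonal_map (map_zero _), Matrix.map_map]
  simp [Function.comp_def, rename_X]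

/-- The determinant of an `m × m` matrix of affine linear forms has total degree `≤ m`
(Leibniz expansion, one degree per column); hence `HasDetRepr p m → totalDegree p ≤ m`. [folklore]
-- adapted from Literature.Computability.AlgebraicComplexity.totalDegree_le_of_hasDetRepr_holds -/
theorem totalDegree_le_of_hasDetRepr {σ : Type} {p : MvPolynomial σ ℂ} {m : ℕ}
    (h : HasDetRepr p m) : p.totalDegree ≤ m := by
  obtain ⟨A, hA, rfl⟩ := h
  simpa using Literature.LinearAlgebra.Matrix.totalDegree_det_le A (fun _ => 1) hA

/-- Size arithmetic of the two-variable case: `2m ≤ 2 ^ (log₂ m + 2) ≤ 2 ^ ((log₂ (m + N) + 2) ^ 2)`.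
[folklore] -/
theorem two_mul_le_pow_sq_log (m N : ℕ) : 2 * m ≤ 2 ^ ((Nat.log 2 (m + N) + 2) ^ 2) := by
  have h1 : m < 2 ^ (Nat.log 2 m + 1) := Nat.lt_pow_succ_log_self one_lt_two m
  have h2 : Nat.log 2 m ≤ Nat.log 2 (m + N) := Nat.log_mono_right (Nat.le_add_right m N)
  have h3 : Nat.log 2 m + 2 ≤ (Nat.log 2 (m + N) + 2) ^ 2 := by
    calc Nat.log 2 m + 2 ≤ Nat.log 2 (m + N) + 2 := Nat.add_le_add_right h2 2
      _ ≤ (Nat.log 2 (m + N) + 2) ^ 2 := by rw [sq]; exact Nat.le_mul_self _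
  calc 2 * m ≤ 2 * 2 ^ (Nat.log 2 m + 1) := Nat.mul_le_mul_left 2 h1.le
    _ = 2 ^ (Nat.log 2 m + 2) := by ring
    _ ≤ 2 ^ ((Nat.log 2 (m + N) + 2) ^ 2) := Nat.pow_le_pow_right two_pos h3

/-! ### The two-variable case of the crux -/

/-- **Two-variable case of crux `PriceOfContractivity` (line `birth`), conditional on
[GrinshpanEtAl2014, Thm. 2.1]** (the first hypothesis, verbatim: every non-constant bivariate `p`
with `p(0) = 1` and no zero in the open polydisc `r𝔻²` is `det (1 + diag (X ∘ κ) · K)` with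
`#κ⁻¹(j) = deg_j p` and `‖K‖_op ≤ r⁻¹`).  For `#σ ≤ N ≤ 2` the normalised polynomial `p / p(0)` is
a renamed bivariate polynomial with no zero on the closed radius-`2` bidisc, of total degree `≤ m`
(it is `p(0)⁻¹` times an `m × m` affine determinant), so the hypothesis at `r = 2` realizes it with
`‖K‖_op ≤ 1/2 ≤ 1` at size `deg₀ + deg₁ ≤ 2m ≤ 2 ^ ((log₂ (m + N) + 2) ^ 2)` (size `0` when it is
constant): the conclusion of `PriceOfContractivity` with `d = 2`, restricted to `N ≤ 2`. [folklore] -/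
theorem stub_priceOfContractivity_twoVar :
    (∀ (p : MvPolynomial (Fin 2) ℂ) (r : ℝ), 0 < r →
      MvPolynomial.eval (0 : Fin 2 → ℂ) p = 1 → 0 < p.totalDegree →
      (∀ z : Fin 2 → ℂ, (∀ j, ‖z j‖ < r) → MvPolynomial.eval z p ≠ 0) →
      ∃ (K : Matrix (Fin (p.degreeOf 0 + p.degreeOf 1)) (Fin (p.degreeOf 0 + p.degreeOf 1)) ℂ)
        (κ : Fin (p.degreeOf 0 + p.degreeOf 1) → Fin 2),
        (∀ j : Fin 2, (Finset.univ.filter fun i => κ i = j).card = p.degreeOf j) ∧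
        ‖Matrix.toEuclideanCLM (𝕜 := ℂ) K‖ ≤ r⁻¹ ∧
        p = (1 + Matrix.diagonal (fun i => MvPolynomial.X (κ i)) *
              K.map (fun a : ℂ => (MvPolynomial.C a : MvPolynomial (Fin 2) ℂ))).det) →
    ∀ (N m : ℕ) {σ : Type} [Fintype σ] (p : MvPolynomial σ ℂ), N ≤ 2 → Fintype.card σ ≤ N →
      Literature.Computability.AlgebraicComplexity.HasDetRepr p m →
      (∀ z : σ → ℂ, (∀ j, ‖z j‖ ≤ 2) → MvPolynomial.eval z p ≠ 0) →
      ∃ R ≤ 2 ^ ((Nat.log 2 (m + N) + 2) ^ 2), ∃ (K : Matrix (Fin R) (Fin R) ℂ) (κ : Fin R → σ),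
        ‖Matrix.toEuclideanCLM (𝕜 := ℂ) K‖ ≤ 1 ∧
        p = MvPolynomial.C (MvPolynomial.eval 0 p) *
          (1 + Matrix.diagonal (fun i => MvPolynomial.X (κ i)) * K.map (fun a : ℂ => (MvPolynomial.C a : MvPolynomial σ ℂ))).det := by
  classical
  intro hGKVVW N m σ _ p hN hσ hrep hz
  -- `p(0) ≠ 0`, by zero-freeness at the origin
  have hp0 : MvPolynomial.eval (0 : σ → ℂ) p ≠ 0 := hz 0 (fun j => by simp)
  set c : ℂ := MvPolynomial.eval (0 : σ → ℂ) p with hc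
  -- the normalised polynomial `q = p / p(0)`
  set q : MvPolynomial σ ℂ := MvPolynomial.C c⁻¹ * p with hq
  have hpq : p = MvPolynomial.C c * q := by
    rw [hq, ← mul_assoc, ← C_mul, mul_inv_cancel₀ hp0, C_1, one_mul]
  have hq0 : MvPolynomial.eval (0 : σ → ℂ) q = 1 := by
    rw [hq, map_mul, eval_C, ← hc, inv_mul_cancel₀ hp0]
  have hqz : ∀ z : σ → ℂ, (∀ j, ‖z j‖ ≤ 2) → MvPolynomial.eval z q ≠ 0 := by
    intro z hzj
    rw [hq, map_mul, eval_C]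
    exact mul_ne_zero (inv_ne_zero hp0) (hz z hzj)
  have hqdeg : q.totalDegree ≤ m :=
    calc q.totalDegree
        ≤ (MvPolynomial.C c⁻¹ : MvPolynomial σ ℂ).totalDegree + p.totalDegree := totalDegree_mul _ _
      _ ≤ m := by rw [totalDegree_C, zero_add]; exact totalDegree_le_of_hasDetRepr hrep
  -- an injection `σ ↪ Fin 2` and the bivariate avatar `qh = rename f q`
  obtain ⟨f⟩ : Nonempty (σ ↪ Fin 2) :=
    Function.Embedding.nonempty_iff_card_le.mpr (by rw [Fintype.card_fin]; exact hσ.trans hN)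
  set qh : MvPolynomial (Fin 2) ℂ := MvPolynomial.rename f q with hqh
  have hqh0 : MvPolynomial.eval (0 : Fin 2 → ℂ) qh = 1 := by
    rw [hqh, eval_rename]
    exact hq0
  have hqhz : ∀ zh : Fin 2 → ℂ, (∀ j, ‖zh j‖ < 2) → MvPolynomial.eval zh qh ≠ 0 := by
    intro zh hzh
    rw [hqh, eval_rename]
    exact hqz _ (fun j => (hzh (f j)).le)
  have hqhdeg : qh.totalDegree ≤ m := (totalDegree_rename_le _ _).trans hqdeg
  by_cases hconst : qh.totalDegree = 0
  · -- constant case: `qh = 1`, so `q = 1` and `p = C (p 0)`, realized by the empty matrix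
    have hqh1 : qh = 1 := by
      have h : qh = MvPolynomial.C (qh.coeff 0) := totalDegree_eq_zero_iff_eq_C.mp hconst
      rw [h] at hqh0
      rw [eval_C] at hqh0
      rw [h, hqh0, C_1]
    have hq1 : q = 1 := by
      apply rename_injective _ f.injective
      rw [← hqh, hqh1, map_one]
    refine ⟨0, Nat.zero_le _, 0, Fin.elim0, by simp, ?_⟩
    rw [Matrix.det_isEmpty, mul_one, hpq, hq1, mul_one]
  · -- non-constant case: the two-variable theorem at radius `r = 2`, renamed back to `σ`
    have hne : Nonempty σ := by
      by_contra h
      haveI : IsEmpty σ := not_nonempty_iff.mp h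
      apply hconst
      rw [hqh, eq_C_of_isEmpty q, rename_C, totalDegree_C]
    set g : Fin 2 → σ := Function.invFun f with hg
    have hgf : g ∘ f = id := Function.invFun_comp f.injective
    have hqg : q = MvPolynomial.rename g qh := by
      rw [hqh, rename_rename, hgf, rename_id_apply]
    obtain ⟨K, κq, -, hK, hrepr⟩ :=
      hGKVVW qh 2 two_pos hqh0 (Nat.pos_of_ne_zero hconst) hqhz
    refine ⟨qh.degreeOf 0 + qh.degreeOf 1, ?_, K, fun i => g (κq i), hK.trans (by norm_num), ?_⟩
    · calc qh.degreeOf 0 + qh.degreeOf 1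
          ≤ m + m := Nat.add_le_add ((degreeOf_le_totalDegree qh 0).trans hqhdeg)
            ((degreeOf_le_totalDegree qh 1).trans hqhdeg)
        _ = 2 * m := (two_mul m).symm
        _ ≤ 2 ^ ((Nat.log 2 (m + N) + 2) ^ 2) := two_mul_le_pow_sq_log m N
    · rw [hpq, hqg, ← rename_pencil_det g K κq, ← hrepr]

end Summit.ValiantsHypothesis.ValiantsHypothesis.Theorems.PriceOfContractivity.TwoVar
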